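import Mathlib.Topology.Algebra.ClopenNhdofOne
import Mathlib.Topology.Algebra.OpenSubgroup
import Mathlib.Topology.Algebra.Group.Quotient
import Mathlib.GroupTheory.Perm.Cycle.Type
import Mathlib.Data.Nat.Factorization.Basic
import Literature.IUT.HodgeTheaters.TemperedCoveringsCompactSubgroups
import HarnessLib

/-!
# "The unique maximal pro-`Σ` subgroup of `I_x`" ([IUTchI] Cor. 2.5, p. 51): the pro-`l` part of a compact abelian group, PROOFS

Mochizuki, *Inter-universal Teichmüller theory I*, kurims manuscript (May 2020), §2, proof of
Cor. 2.5, p. 51 [cite: Mochizuki2012, Cor 2.5 p.51] (D-0012 claim key; series status DISPUTED —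
nothing on this page is contested): "when `x` is a cusp of `X` [so `I_x ≅ Ẑ(1)`], it follows — i.e.,
by applying Proposition 2.4, (i), to the unique maximal pro-`Σ` subgroup of `I_x` — that …".  The
kernel of that step (`StableCurveTemperedData.cor25Inertia_of_prop24i`, abc-iut-L5-t11,
`TemperedCoveringsProofs.lean`) takes as HYPOTHESIS the atom "`I_x` contains a nontrivial compact
pro-`Σ` subgroup".  This PROOF-ONLY file (no definitions; nothing printed is asserted) supplies the
topological group theory behind the atom, which Mathlib lacks (Sylow theory of profinite groups):
for a prime `l` and a compact topological group `Z` in which any two elements commute, the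
*pro-`l` part* `Z_(l) := {x ∈ Z | the image of x in every discrete quotient Z/W has l-power order}`
(`W` ranging over the open normal subgroups) is a CLOSED SUBGROUP (`exists_subgroup_proLPart`,
`isClosed_proLPart`); when `Z` is profinite, EVERY subgroup of `Z_(l)` is pro-`Σ` for any `Σ ∋ l`
(`isProSigma_of_forall_exists_pow_mem` — with the tree's definition
`Literature.AnabelianGeometry.SemiGraphs.IsProSigma`, which quantifies over the finite discrete
quotients of the subgroup with its subspace topology); and `Z_(l)` is INFINITE as soon as `Z` has
discrete quotients containing elements of order `l ^ (n + 1)` for every `n` (`infinite_proLPart`, a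
compactness argument: the pro-`l` lifts of such an element form a directed family of nonempty closed
sets).  Consequently every finite-index subgroup `J ⊆ Z` contains a nontrivial compact pro-`Σ`
subgroup (`exists_compact_proSigma_le_of_finiteIndex`) — the shape of the hypothesis `hI` of
`cor25Inertia_of_prop24i`; the instance `Z = Ẑ ≅ I_x` is treated in a sequel file.
-/

namespace Literature.IUT.HodgeTheaters

open Topology
open Literature.AnabelianGeometry.SemiGraphs (IsProSigma)

section ProLPart

variable {Z : Type*} [Group Z] [TopologicalSpace Z] [IsTopologicalGroup Z]

/-- For an open normal subgroup `W ⊆ Z`, the set of `x ∈ Z` whose image in the (discrete, since `W`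
is open) quotient `Z/W` has order a power of `l` — i.e. `x ^ (l ^ n) ∈ W` for some `n` — is clopen:
it is the preimage of a subset of a discrete space. [cite: Mochizuki2012, Cor 2.5 p.51] -/
theorem isClopen_setOf_exists_pow_mem (l : ℕ) (W : OpenNormalSubgroup Z) :
    IsClopen {x : Z | ∃ n : ℕ, x ^ l ^ n ∈ W.toSubgroup} := by
  haveI : DiscreteTopology (Z ⧸ W.toSubgroup) := QuotientGroup.discreteTopology W.isOpen'
  have e : {x : Z | ∃ n : ℕ, x ^ l ^ n ∈ W.toSubgroup} =
      QuotientGroup.mk ⁻¹' {q : Z ⧸ W.toSubgroup | ∃ n : ℕ, q ^ l ^ n = 1} := by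
    ext x
    simp only [Set.mem_setOf_eq, Set.mem_preimage, ← QuotientGroup.mk_pow,
      QuotientGroup.eq_one_iff]
  rw [e]
  exact (isClopen_discrete _).preimage QuotientGroup.continuous_mk

omit [IsTopologicalGroup Z] in
/-- **The pro-`l` part is a subgroup** (for `Z` with commuting elements — e.g. `Z ≅ Ẑ`): the set
`Z_(l)` of `x ∈ Z` such that for every open normal subgroup `W` some `x ^ (l ^ n)` lies in `W` is
(the carrier of) a subgroup.  [Commutativity is used for products: `(ab)^{lᵐ⁺ⁿ} = a^{lᵐ⁺ⁿ} b^{lᵐ⁺ⁿ}`.]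
[cite: Mochizuki2012, Cor 2.5 p.51] -/
theorem exists_subgroup_proLPart (l : ℕ) (hc : ∀ a b : Z, a * b = b * a) :
    ∃ P : Subgroup Z, ∀ x, x ∈ P ↔ ∀ W : OpenNormalSubgroup Z, ∃ n : ℕ, x ^ l ^ n ∈ W.toSubgroup := by
  refine ⟨{ carrier := {x | ∀ W : OpenNormalSubgroup Z, ∃ n : ℕ, x ^ l ^ n ∈ W.toSubgroup}
            mul_mem' := ?_
            one_mem' := ?_
            inv_mem' := ?_ }, fun x => Iff.rfl⟩
  · intro a b ha hb W
    obtain ⟨m, hm⟩ := ha W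
    obtain ⟨n, hn⟩ := hb W
    refine ⟨m + n, ?_⟩
    rw [Commute.mul_pow (hc a b)]
    refine W.toSubgroup.mul_mem ?_ ?_
    · rw [pow_add, pow_mul]
      exact W.toSubgroup.pow_mem hm _
    · rw [pow_add, mul_comm, pow_mul]
      exact W.toSubgroup.pow_mem hn _
  · intro W
    exact ⟨0, by rw [one_pow]; exact W.toSubgroup.one_mem⟩
  · intro x hx W
    obtain ⟨n, hn⟩ := hx W
    exact ⟨n, by rw [inv_pow]; exact W.toSubgroup.inv_mem hn⟩

/-- **The pro-`l` part is closed**: an intersection of clopen sets. [cite: Mochizuki2012, Cor 2.5 p.51] -/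
theorem isClosed_proLPart (l : ℕ) :
    IsClosed {x : Z | ∀ W : OpenNormalSubgroup Z, ∃ n : ℕ, x ^ l ^ n ∈ W.toSubgroup} := by
  have e : {x : Z | ∀ W : OpenNormalSubgroup Z, ∃ n : ℕ, x ^ l ^ n ∈ W.toSubgroup} =
      ⋂ W : OpenNormalSubgroup Z, {x | ∃ n : ℕ, x ^ l ^ n ∈ W.toSubgroup} := by
    ext x
    simp only [Set.mem_setOf_eq, Set.mem_iInter]
  rw [e]
  exact isClosed_iInter fun W => (isClopen_setOf_exists_pow_mem l W).isClosed

/-- **Every subgroup of the pro-`l` part of a profinite group is pro-`Σ`** (`l ∈ Σ`), for the tree's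
`IsProSigma` (finite discrete quotients of the subgroup `Q` with its subspace topology): an open
normal subgroup `V` of `Q` contains the trace `Q ∩ W` of an open normal subgroup `W` of `Z`; an
element of prime order `p` in `Q/V` (Cauchy) lifts to `y ∈ Q` with `y ^ (l ^ n) ∈ W`, so `p ∣ l ^ n`
and `p = l`. [cite: Mochizuki2012, Cor 2.5 p.51] -/
theorem isProSigma_of_forall_exists_pow_mem [CompactSpace Z] [TotallyDisconnectedSpace Z]
    {l : ℕ} (hl : l.Prime) {S : Set ℕ} (hlS : l ∈ S) (Q : Subgroup Z)
    (hQ : ∀ x ∈ Q, ∀ W : OpenNormalSubgroup Z, ∃ n : ℕ, x ^ l ^ n ∈ W.toSubgroup) :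
    IsProSigma S Q := by
  refine ⟨fun V hfin p hp hdvd => ?_⟩
  haveI := hfin
  haveI : Fact p.Prime := ⟨hp⟩
  obtain ⟨q, hq⟩ := exists_prime_orderOf_dvd_card' p hdvd
  obtain ⟨y, rfl⟩ := QuotientGroup.mk_surjective q
  -- `V` is the trace on `Q` of an open `O ∋ 1`; shrink `O` to an open normal subgroup `W` of `Z`
  obtain ⟨O, hO, hOV⟩ : ∃ O : Set Z, IsOpen O ∧ Subtype.val ⁻¹' O = (V : Set Q) :=
    isOpen_induced_iff.mp V.isOpen'
  have h1O : (1 : Z) ∈ O := by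
    have h1 : (1 : Q) ∈ Subtype.val ⁻¹' O := by
      rw [hOV]
      exact V.toSubgroup.one_mem
    exact h1
  obtain ⟨W, hW⟩ := ProfiniteGrp.exist_openNormalSubgroup_sub_open_nhds_of_one hO h1O
  obtain ⟨n, hn⟩ := hQ y y.2 W
  have hyV : y ^ l ^ n ∈ V.toSubgroup := by
    have h' : (y ^ l ^ n : Q) ∈ Subtype.val ⁻¹' O := by
      rw [Set.mem_preimage, Subgroup.coe_pow]
      exact hW hn
    rw [hOV] at h'
    exact h'
  have hdvd' : p ∣ l ^ n := by
    rw [← hq]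
    refine orderOf_dvd_of_pow_eq_one ?_
    rw [← QuotientGroup.mk_pow, QuotientGroup.eq_one_iff]
    exact hyV
  have hpl : p = l := (Nat.prime_dvd_prime_iff_eq hp hl).mp (hp.dvd_of_dvd_pow hdvd')
  rw [hpl]
  exact hlS

/-- **The pro-`l` part is infinite** when `Z` (compact) has, for every `n`, a discrete quotient
`Z/W` with an element of order `l ^ (n + 1)` (e.g. `Z ≅ Ẑ`).  [Compactness: if `z mod W₀` has order
`l ^ (N + 1)`, the sets `K_W` of pro-`l`-mod-`W` elements congruent to `z` mod `W₀` are closed,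
nonempty (a suitable power `z ^ (m c)`, `m` the prime-to-`l` part of the order of `z` mod `W`,
`m c ≡ 1 mod l ^ (N + 1)`) and directed, so they have a common point `x ∈ Z_(l)`, whose order is a
multiple of `l ^ (N + 1) > N`; so `Z_(l)` cannot have `N` elements.]
[cite: Mochizuki2012, Cor 2.5 p.51] -/
theorem infinite_proLPart [CompactSpace Z] {l : ℕ} (hl : l.Prime) (P : Subgroup Z)
    (hP : ∀ x, x ∈ P ↔ ∀ W : OpenNormalSubgroup Z, ∃ n : ℕ, x ^ l ^ n ∈ W.toSubgroup)
    (hyp : ∀ n : ℕ, ∃ (W : OpenNormalSubgroup Z) (z : Z),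
      z ^ l ^ (n + 1) ∈ W.toSubgroup ∧ z ^ l ^ n ∉ W.toSubgroup) :
    (P : Set Z).Infinite := by
  intro hfin
  haveI : Finite P := hfin.to_subtype
  haveI : Fact l.Prime := ⟨hl⟩
  set N : ℕ := Nat.card P with hN
  have hNpos : 0 < N := Nat.card_pos
  obtain ⟨W₀, z, hz1, hz0⟩ := hyp N
  -- the order of `z` modulo `W₀` is `l ^ (N + 1)`
  have horder : orderOf (QuotientGroup.mk z : Z ⧸ W₀.toSubgroup) = l ^ (N + 1) := by
    refine orderOf_eq_prime_pow (fun h => hz0 ?_) ?_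
    · rw [← QuotientGroup.mk_pow, QuotientGroup.eq_one_iff] at h
      exact h
    · rw [← QuotientGroup.mk_pow, QuotientGroup.eq_one_iff]
      exact hz1
  -- the directed family of closed nonempty sets `K W`
  set K : OpenNormalSubgroup Z → Set Z := fun W =>
    {x | (QuotientGroup.mk x : Z ⧸ W₀.toSubgroup) = QuotientGroup.mk z} ∩
      {x | ∃ n : ℕ, x ^ l ^ n ∈ W.toSubgroup} with hK
  have hKclosed : ∀ W, IsClosed (K W) := by
    intro W
    refine IsClosed.inter ?_ (isClopen_setOf_exists_pow_mem l W).isClosed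
    haveI : DiscreteTopology (Z ⧸ W₀.toSubgroup) := QuotientGroup.discreteTopology W₀.isOpen'
    exact (isClosed_discrete {QuotientGroup.mk z}).preimage QuotientGroup.continuous_mk
  have hKne : ∀ W, (K W).Nonempty := by
    intro W
    haveI : Finite (Z ⧸ W.toSubgroup) := Subgroup.quotient_finite_of_isOpen _ W.isOpen'
    -- the order of `z` mod `W`: `o = l ^ a * m` with `l ∤ m`
    obtain ⟨a, m, hlm, ho⟩ := Nat.exists_eq_pow_mul_and_not_dvd
      (orderOf_pos (QuotientGroup.mk z : Z ⧸ W.toSubgroup)).ne' l hl.one_lt.ne'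
    have hcop : Nat.Coprime m (l ^ (N + 1)) :=
      (Nat.Coprime.pow_left (N + 1) ((Nat.Prime.coprime_iff_not_dvd hl).mpr hlm)).symm
    obtain ⟨c, -, hc⟩ := Nat.exists_mul_mod_eq_one_of_coprime hcop
      (Nat.one_lt_pow (Nat.succ_ne_zero N) hl.one_lt)
    refine ⟨z ^ (m * c), ?_, ⟨a, ?_⟩⟩
    · -- `z ^ (m c) ≡ z` mod `W₀` since `m c ≡ 1` mod `l ^ (N + 1) = ord(z mod W₀)`
      show (QuotientGroup.mk (z ^ (m * c)) : Z ⧸ W₀.toSubgroup) = QuotientGroup.mk z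
      rw [QuotientGroup.mk_pow, ← pow_mod_orderOf, horder, hc, pow_one]
    · -- `(z ^ (m c)) ^ (l ^ a) = (z ^ o) ^ c ∈ W`
      rw [← QuotientGroup.eq_one_iff, QuotientGroup.mk_pow, QuotientGroup.mk_pow, ← pow_mul,
        show m * c * l ^ a = (l ^ a * m) * c by ring, pow_mul, ← ho, pow_orderOf_eq_one, one_pow]
  have hKdir : Directed (· ⊇ ·) K := by
    intro W₁ W₂
    refine ⟨W₁ ⊓ W₂, ?_, ?_⟩
    · rintro x ⟨hx0, n, hn⟩
      exact ⟨hx0, n, (Subgroup.mem_inf.mp hn).1⟩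
    · rintro x ⟨hx0, n, hn⟩
      exact ⟨hx0, n, (Subgroup.mem_inf.mp hn).2⟩
  haveI : Nonempty (OpenNormalSubgroup Z) := ⟨W₀⟩
  obtain ⟨x, hx⟩ := IsCompact.nonempty_iInter_of_directed_nonempty_isCompact_isClosed K hKdir
    hKne (fun W => (hKclosed W).isCompact) hKclosed
  have hxK : ∀ W, x ∈ K W := Set.mem_iInter.mp hx
  have hxP : x ∈ P := (hP x).mpr fun W => (hxK W).2
  have hxz : (QuotientGroup.mk x : Z ⧸ W₀.toSubgroup) = QuotientGroup.mk z := (hxK W₀).1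
  have h1 : orderOf (QuotientGroup.mk x : Z ⧸ W₀.toSubgroup) ∣ orderOf x :=
    orderOf_map_dvd (QuotientGroup.mk' W₀.toSubgroup) x
  rw [hxz, horder] at h1
  have h2 : orderOf x ∣ N := P.orderOf_dvd_natCard hxP
  have h3 : l ^ (N + 1) ≤ N := Nat.le_of_dvd hNpos (h1.trans h2)
  have h4 : N < l ^ (N + 1) :=
    (Nat.lt_pow_self hl.one_lt).trans_le (Nat.pow_le_pow_right hl.pos N.le_succ)
  exact absurd h3 (not_le.mpr h4)

/-- **Nontrivial compact pro-`Σ` subgroups inside finite-index subgroups.**  Let `Z` be a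
profinite group with commuting elements which has, for every `n`, a discrete quotient containing
an element of order `l ^ (n + 1)` (`l` prime; e.g. `Z ≅ Ẑ`), and let `l ∈ Σ`.  Then every
finite-index subgroup `J ⊆ Z` contains a nontrivial compact subgroup `Λ` which is pro-`Σ` (indeed
pro-`l`) — namely a nontrivial compact subgroup of `Z_(l) ∩ J` (`exists_compact_le_inf_of_finiteIndex`
applied to the infinite compact `Z_(l)`).  This is the printed atom "the unique maximal pro-`Σ`
subgroup of `I_x`" in the shape consumed by `StableCurveTemperedData.cor25Inertia_of_prop24i`.
[cite: Mochizuki2012, Cor 2.5 p.51] -/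
theorem exists_compact_proSigma_le_of_finiteIndex [CompactSpace Z] [TotallyDisconnectedSpace Z]
    [T2Space Z] {l : ℕ} (hl : l.Prime) {S : Set ℕ} (hlS : l ∈ S)
    (hc : ∀ a b : Z, a * b = b * a)
    (hyp : ∀ n : ℕ, ∃ (W : OpenNormalSubgroup Z) (z : Z),
      z ^ l ^ (n + 1) ∈ W.toSubgroup ∧ z ^ l ^ n ∉ W.toSubgroup)
    (J : Subgroup Z) [J.FiniteIndex] :
    ∃ Λ : Subgroup Z, Λ ≤ J ∧ IsCompact (Λ : Set Z) ∧ Λ ≠ ⊥ ∧ IsProSigma S Λ := by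
  obtain ⟨P, hP⟩ := exists_subgroup_proLPart (Z := Z) l hc
  have hPc : IsCompact (P : Set Z) := by
    have e : (P : Set Z) = {x : Z | ∀ W : OpenNormalSubgroup Z, ∃ n : ℕ, x ^ l ^ n ∈ W.toSubgroup} := by
      ext x
      exact hP x
    rw [e]
    exact (isClosed_proLPart l).isCompact
  have hPinf : (P : Set Z).Infinite := infinite_proLPart hl P hP hyp
  obtain ⟨Λ, hΛle, hΛc, hΛne⟩ := exists_compact_le_inf_of_finiteIndex hPc hPinf J
  exact ⟨Λ, hΛle.trans inf_le_right, hΛc, hΛne,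
    isProSigma_of_forall_exists_pow_mem hl hlS Λ fun x hx => (hP x).mp (hΛle hx).1⟩

end ProLPart

end Literature.IUT.HodgeTheaters
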